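import Literature.Analysis.FluidPDE.PerturbedNSFourierSolution
import Literature.Analysis.FluidPDE.NavierStokesConcentrationCorrectorProofs
import Literature.Analysis.FunctionSpaces.TorusSobolevNorm
import HarnessLib

/-!
# The perturbed Navier–Stokes system around a smooth field on the flat torus: short-time
# smooth solutions with a life span uniform in the start time and in `H⁴`-bounded data

Function-space support file (all results proved; no definitions, no named facts), the
NONLINEAR companion of `TorusLinearisedNSExistence`. Fix `ν > 0` and a jointly smooth
velocity field `u` on `[a, b] × T^d` (`a < b`, `#d ≤ 3`) with divergence-free slices. The
**perturbed Navier–Stokes system around `u`** (the Cheskidov–Luo perturbation / corrector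
system, Cheskidov–Luo 2022, §3.1 (3.2), with zero stress, a nonzero datum and viscosity `ν`;
if `u` solves `NS_ν(F)` then `u + v` solves `NS_ν(F)` with datum `u(t₀) + v₀` — the body
force is absorbed by the background),

`∂ₜv + (v·∇)v + (u·∇)v + (v·∇)u = νΔv − ∇q`, `div v = 0`, `∫ v = 0`,

has, for every `M`, a life span `θ = θ(d, ν, u, M) > 0` such that from every start time
`t₀ ∈ [a, b]` with `t₀ + θ ≤ b` and every smooth divergence-free mean-zero datum `v₀` whose
fourth Sobolev sums are bounded by `M` (`∑_{k∈S} (1+|k|²)⁴‖v̂₀(k)‖² ≤ M` for all finite `S`)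
there is a solution `(v, q)` jointly smooth on `[t₀, t₀ + θ] × T^d` with `v(t₀) = v₀`, `v(t)`
divergence free and mean zero, `q(t)` mean zero (`Torus.perturbedNS_exists_local`). This is
the short-time `H^m` theory (Majda–Bertozzi 2002, Thm. 3.4: the life span depends on the datum
only through `‖v₀‖_{H^m}`, `m > d/2 + 1`; here `m = 4`) in the uniform form consumed by
continuation arguments. As in the sibling files no predicate is introduced: the clauses are
listed separately.

## Proof road

The Fourier–Picard construction of `Literature/Analysis/FluidPDE/PerturbedNSFourier*`
(`PerturbedNSFourier.vel_isSolution`: mild formulation of the Leray-projected system on the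
frequency lattice, Picard iteration contracting on a short interval in the ORDER-FOUR weighted
sup-norm — the datum enters only through `sup (1+‖k‖)⁴|v̂₀(k)| ≤ 4√M`
(`GalerkinSmooth.hasDecay_of_weighted_sq_le`) and the background only through a sup-in-time
order-four decay constant on the compact `[a, b]`
(`ScalarFourier.exists_hasDecay_mFourierCoeff_spaceTime`), whence the uniform threshold
`PerturbedNSFourier.exists_threshold`; bootstrap of every decay and of time regularity,
synthesis, reality) on the model interval `[0, θ]` for the translated background `u(· + t₀)`,
translated back to `[t₀, t₀ + θ]` (`Torus.IsSmoothSpaceTimeOn.comp_sub_const_Icc`,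
`Torus.timeDerivWithin_comp_sub_const_Icc`). This is NOT the energy road of Majda–Bertozzi;
the statement is theirs (for the perturbation system, with the background absorbed).

## References

* A. J. Majda, A. L. Bertozzi, *Vorticity and Incompressible Flow*, CUP 2002, Thm. 3.4.
  [`MajdaBertozziCUP2002`]
* A. Cheskidov, X. Luo, *Sharp nonuniqueness for the Navier–Stokes equations*, Invent. Math.
  229 (2022), §3.1 (3.2), Prop. 3.2. [`CheskidovLuo2022`]
-/

open MeasureTheory Set Filter
open scoped InnerProductSpace ContDiff Topology

noncomputable section

namespace Literature.Analysis.FunctionSpaces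

namespace Torus

open Literature.Analysis.FluidPDE.FourierNS (HasDecay)

variable {d : Type*} [Fintype d] [DecidableEq d]

variable {ν a b : ℝ} {u : ℝ → UnitAddTorus d → EuclideanSpace ℝ d}

/-- **Short-time smooth solutions of the perturbed Navier–Stokes system on `T^d`, `#d ≤ 3`, with
a life span uniform in the start time and in `H⁴`-bounded data.** For `ν > 0`, `a < b`, a
velocity field `u` jointly smooth on `[a, b] × T^d` with divergence-free slices, and every `M`,
there is `θ > 0` such that: from every `t₀ ∈ [a, b]` with `t₀ + θ ≤ b` and every smooth
divergence-free mean-zero `v₀` with `∑_{k∈S} (1+|k|²)⁴‖v̂₀(k)‖² ≤ M` for all finite `S`, the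
system `∂ₜv + (v·∇)v + (u·∇)v + (v·∇)u = νΔv − ∇q`, `div v = 0` has a solution `(v, q)`
jointly smooth on `[t₀, t₀ + θ] × T^d` (one-sided time derivative
`Torus.timeDerivWithin (Icc t₀ (t₀ + θ))`) with `v(t)` divergence free and mean zero, `q(t)`
mean zero, and `v(t₀) = v₀` (Majda–Bertozzi 2002, Thm. 3.4: local `H^m` theory with
`T = T(‖v₀‖_{H^m})`, `m > d/2 + 1`; Cheskidov–Luo 2022, §3.1 (3.2) for the perturbation
system). Proof: the Fourier–Picard construction `PerturbedNSFourier.vel_isSolution` in the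
order-four ball on `[0, θ]` for `u(· + t₀)`, with the threshold of
`PerturbedNSFourier.exists_threshold` fed by a sup-in-time order-four coefficient bound of `u`
on `[a, b]` and the bound `4√M` of the datum, translated in time. [cite: MajdaBertozziCUP2002, Thm. 3.4] -/
theorem perturbedNS_exists_local (hd : Fintype.card d ≤ 3) (hν : 0 < ν) (hab : a < b)
    (hu : IsSmoothSpaceTimeOn (Icc a b) u) (hudiv : ∀ t ∈ Icc a b, IsDivFree (u t)) (M : ℝ) :
    ∃ θ : ℝ, 0 < θ ∧ ∀ t₀ ∈ Icc a b, t₀ + θ ≤ b →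
      ∀ (v₀ : UnitAddTorus d → EuclideanSpace ℝ d), IsSmooth v₀ → IsDivFree v₀ → HasZeroMean v₀ →
      (∀ S : Finset (d → ℤ),
        ∑ k ∈ S, (1 + freqNormSq k) ^ 4 * ‖UnitAddTorus.mFourierCoeff (EuclideanSpace.complexify ∘ v₀) k‖ ^ 2 ≤ M) →
      ∃ (v : ℝ → UnitAddTorus d → EuclideanSpace ℝ d) (q : ℝ → UnitAddTorus d → ℝ),
        IsSmoothSpaceTimeOn (Icc t₀ (t₀ + θ)) v ∧ IsSmoothSpaceTimeOn (Icc t₀ (t₀ + θ)) q ∧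
        (∀ t ∈ Icc t₀ (t₀ + θ), IsDivFree (v t)) ∧ (∀ t ∈ Icc t₀ (t₀ + θ), HasZeroMean (v t)) ∧
        (∀ t ∈ Icc t₀ (t₀ + θ), HasZeroMean (q t)) ∧
        (∀ t ∈ Icc t₀ (t₀ + θ), ∀ x, timeDerivWithin (Icc t₀ (t₀ + θ)) v t x + convect (v t) (v t) x +
          convect (u t) (v t) x + convect (v t) (u t) x = ν • laplacian (v t) x - gradient (q t) x) ∧
        v t₀ = v₀ := by
  -- the translated background on `[0, T]`, `T = b - a`, and its global order-four coefficient bound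
  set T : ℝ := b - a with hT
  have hT0 : 0 < T := sub_pos.2 hab
  set uT : ℝ → UnitAddTorus d → EuclideanSpace ℝ d := fun s => u (s + a) with huT
  have hpreT : (· + a) ⁻¹' Icc a b = Icc 0 T := by
    rw [FluidPDE.Torus.preimage_add_const_Icc', sub_self]
  have huTs : IsSmoothSpaceTimeOn (Icc 0 T) uT := by
    have h1 := hu.comp_add_const a
    rwa [hpreT] at h1
  have hAj : ∀ j : d, ∃ C : ℝ, 0 ≤ C ∧ ∀ s ∈ Icc 0 T,
      HasDecay 4 C (fun k => UnitAddTorus.mFourierCoeff (FluidPDE.CorrectorFourier.compC uT j s) k) := fun j =>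
    FluidPDE.ScalarFourier.exists_hasDecay_mFourierCoeff_spaceTime hT0 (FluidPDE.CorrectorFourier.isSmoothSpaceTimeOn_compC huTs j) 4
  choose Aj hAj0 hAj using hAj
  set A : ℝ := ∑ j, Aj j with hAdef
  have hA0 : 0 ≤ A := Finset.sum_nonneg fun j _ => hAj0 j
  have hAall : ∀ s ∈ Icc 0 T, ∀ j,
      HasDecay 4 A (fun k => UnitAddTorus.mFourierCoeff (FluidPDE.CorrectorFourier.compC uT j s) k) := fun s hs j =>
    (hAj j s hs).mono (Finset.single_le_sum (fun i _ => hAj0 i) (Finset.mem_univ j))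
  -- the order-four mass, the radius and the threshold
  set Z : ℝ := ∑' m : d → ℤ, ((1 + ‖m‖) ^ 4)⁻¹ with hZdef
  have hZ : HasSum (fun m : d → ℤ => ((1 + ‖m‖) ^ 4)⁻¹) Z := FluidPDE.PerturbedNSFourier.hasSum_weight_four hd
  have hZ0 : 0 ≤ Z := FluidPDE.PerturbedNSFourier.weight_four_mass_nonneg hZ
  set M' : ℝ := max M 0 with hM'
  have hM'0 : 0 ≤ M' := le_max_right _ _
  set ρ : ℝ := 2 * (2 ^ 2 * Real.sqrt M') + 1 with hρdef
  have hρ0 : 0 < ρ := by positivity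
  obtain ⟨θ, hθ, hθ1, hthr⟩ := FluidPDE.PerturbedNSFourier.exists_threshold (d := d) (ν := ν) hρ0 hZ0 hA0
  obtain ⟨hS1, hS2⟩ := hthr θ hθ le_rfl
  refine ⟨θ, hθ, fun t₀ ht₀ hθb v₀ hv₀ hv₀div hv₀mean hMv => ?_⟩
  -- the translated background on `[0, θ]`
  have hsub : Icc t₀ (t₀ + θ) ⊆ Icc a b := Icc_subset_Icc ht₀.1 hθb
  have hmem : ∀ s ∈ Icc 0 θ, s + t₀ ∈ Icc a b := fun s hs =>
    hsub ⟨by linarith [hs.1], by linarith [hs.2]⟩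
  have hpre : (· + t₀) ⁻¹' Icc t₀ (t₀ + θ) = Icc 0 θ := by
    rw [FluidPDE.Torus.preimage_add_const_Icc', sub_self, add_sub_cancel_left]
  set uτ : ℝ → UnitAddTorus d → EuclideanSpace ℝ d := fun s => u (s + t₀) with huτ
  have huτs : IsSmoothSpaceTimeOn (Icc 0 θ) uτ := by
    have h1 := (hu.mono hsub).comp_add_const t₀
    rwa [hpre] at h1
  have hdivτ : ∀ s ∈ Icc 0 θ, IsDivFree (uτ s) := fun s hs => hudiv (s + t₀) (hmem s hs)
  -- the drift coefficients have order-four constant `A` at all times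
  have hUA : ∀ j t, HasDecay 4 A (FluidPDE.CorrectorFourier.driftCoeff θ uτ j t) := by
    refine FluidPDE.CorrectorFourier.hasDecay_driftCoeff_of_forall hθ.le fun s hs j => ?_
    have hsT : s + (t₀ - a) ∈ Icc 0 T :=
      ⟨by linarith [hs.1, ht₀.1], by linarith [hs.2, hθb]⟩
    have heq : FluidPDE.CorrectorFourier.compC uτ j s = FluidPDE.CorrectorFourier.compC uT j (s + (t₀ - a)) := by
      funext x
      simp only [FluidPDE.CorrectorFourier.compC_apply, huτ, huT]
      congr 4
      ring
    rw [heq]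
    exact hAall _ hsT j
  -- the datum lies in the order-four ball of radius `ρ/2`
  have hck : ∀ k, (1 + freqNormSq k) ^ (2 * 2) *
      ‖UnitAddTorus.mFourierCoeff (EuclideanSpace.complexify ∘ v₀) k‖ ^ 2 ≤ M' := by
    intro k
    have h1 := hMv {k}
    rw [Finset.sum_singleton] at h1
    exact (le_of_eq (by norm_num)).trans (h1.trans (le_max_left _ _))
  have hdec : HasDecay (2 * 2) (2 ^ 2 * Real.sqrt M') (fun k => UnitAddTorus.mFourierCoeff (EuclideanSpace.complexify ∘ v₀) k) :=
    FluidPDE.GalerkinSmooth.hasDecay_of_weighted_sq_le hck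
  have ha : ∀ l, HasDecay 4 (ρ / 2) (FluidPDE.LinearisedNSFourier.datumCoeff v₀ l) := by
    intro l k
    have h1 := hdec k
    have h2 : ‖FluidPDE.LinearisedNSFourier.datumCoeff v₀ l k‖ ≤ ‖UnitAddTorus.mFourierCoeff (EuclideanSpace.complexify ∘ v₀) k‖ := by
      rw [FluidPDE.LinearisedNSFourier.datumCoeff_apply, ← mFourierCoeff_complexify_apply hv₀.integrable k l]
      exact PiLp.norm_apply_le _ l
    refine h2.trans (h1.trans ?_)
    have hw : (0 : ℝ) ≤ ((1 + ‖k‖) ^ 4)⁻¹ := by positivity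
    have hρ2 : 2 ^ 2 * Real.sqrt M' ≤ ρ / 2 := by rw [hρdef]; linarith [Real.sqrt_nonneg M']
    exact mul_le_mul_of_nonneg_right hρ2 hw
  -- the Fourier–Picard solution on the model interval and its translation
  have h := FluidPDE.PerturbedNSFourier.ballHyp hν hθ hθ1 huτs hv₀ hZ hρ0.le hA0 hUA ha hS1 hS2
  obtain ⟨h1, h2, h3, h4, h5, h6, h7⟩ :=
    FluidPDE.PerturbedNSFourier.vel_isSolution h huτs hdivτ hv₀ hv₀div hv₀mean
  set w := FluidPDE.PerturbedNSFourier.vel ν θ uτ v₀ with hw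
  set p := FluidPDE.PerturbedNSFourier.pres ν θ uτ v₀ with hp
  have hsubτ : ∀ t ∈ Icc t₀ (t₀ + θ), t - t₀ ∈ Icc 0 θ := fun t ht => ⟨by linarith [ht.1], by linarith [ht.2]⟩
  refine ⟨fun t => w (t - t₀), fun t => p (t - t₀), h1.comp_sub_const_Icc, h2.comp_sub_const_Icc,
    fun t ht => h3 (t - t₀) (hsubτ t ht), fun t ht => h4 (t - t₀) (hsubτ t ht),
    fun t ht => h5 (t - t₀) (hsubτ t ht), fun t ht x => ?_, ?_⟩
  · have hm := h6 (t - t₀) (hsubτ t ht) x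
    simp only [huτ, sub_add_cancel] at hm
    rw [FluidPDE.Torus.timeDerivWithin_comp_sub_const_Icc θ t₀ w t x]
    exact hm
  · change w (t₀ - t₀) = v₀
    rw [sub_self]
    exact h7

end Torus

end Literature.Analysis.FunctionSpaces

end
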